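import Literature.AlgebraicGeometry.HodgeTheory.RibetTypeNinetySevenfoldPowersHodgeClasses
import Literature.AlgebraicGeometry.Motives.HodgeThetaSubalgebraUnitaryOneHundredOneGoodRankCores
import HarnessLib

/-!
# Hodge classes on all powers of abelian varieties of Ribet type `(12, 89)`, `(18, 83)`, `(22, 79)`, `(28, 73)`, `(30, 71)`, `(34, 67)`, `(40, 61)`, `(42, 59)`, `(48, 53)` are generated by divisor classes
# (Ribet 1983 Thm. 3 at these multiplicities — UNCONDITIONAL); the first census of SIMPLE ABELIAN 101-FOLDS

Family `hodge`, layer `Literature/AlgebraicGeometry/HodgeTheory`. Research context: cell `pub-hodge-ring2` (HONEST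
FRAMING: research route conditional on HC_CM; not a corollary; Q11.4-sentence-2 already refuted in dim ≥ 3),
Literature lane gen 90. UNCONDITIONAL for the class of abelian varieties it names; theorems only, no definition, no
named fact (D-0026), no `sorry`. The CELLS of the generic assembly `RibetTypeOfCoreSmulPowersHodgeClasses` at the
good-rank cores of `Motives/HodgeThetaSubalgebraUnitaryOneHundredOneGoodRankCores` (every raising rank is good), and the
census of the prime dimension `101` they begin (`isDivisorGenerated_powSucc_of_isSimple_of_prime_of_odd_of_ge_eight_notin`
grants only the imaginary-quadratic shapes with both multiplicities `≥ 8` and `∉ {11, 13}`; of these `{12, 89}`, `{18, 83}`, `{22, 79}`, `{28, 73}`, `{30, 71}`, `{34, 67}`, `{40, 61}`, `{42, 59}`, `{48, 53}`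
are theorems here), exactly as `RibetTypeFortyThreefoldPowersHodgeClasses` did for `43`.

THE PRINTED THEOREM. Ribet, Amer. J. Math. 105 (1983), Thm. 3 = Gordon's survey Thm. 6.3 (3) [held
`paper:arxiv-alg-geom_9709030` p. 18]: for an abelian variety `A` with `End⁰(A)` an imaginary quadratic field `K` acting
with relatively prime multiplicities `(n′, n″)`, `Hg(A) = Lf(A)` and the Hodge ring of every power of `A` is generated by
divisors (ibid. Thm. 6.2 = Ribet Thm. 0).

* §1 the cells `(12, 89)`, `(18, 83)`, `(22, 79)`, `(28, 73)`, `(30, 71)`, `(34, 67)`, `(40, 61)`, `(42, 59)`, `(48, 53)` (and mirrors), the Hodge conjecture for these powers, 101-FOLDS of these signatures.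
* §2 `isDivisorGenerated_powSucc_of_isSimple_onehundredonefold`: `B• = D•` on all powers of a simple `101`-fold granted
  only `End⁰ = ℚ` and the `k`-signatures `{8, 93}`, `{9, 92}`, `{10, 91}`, `{14, 87}`, `{15, 86}`, `{16, 85}`, `{17, 84}`, `{19, 82}`, `{20, 81}`, `{21, 80}`, `{23, 78}`, `{24, 77}`, `{25, 76}`, `{26, 75}`, `{27, 74}`, `{29, 72}`, `{31, 70}`, `{32, 69}`, `{33, 68}`, `{35, 66}`, `{36, 65}`, `{37, 64}`, `{38, 63}`, `{39, 62}`, `{41, 60}`, `{43, 58}`, `{44, 57}`, `{45, 56}`, `{46, 55}`, `{47, 54}`, `{49, 52}`, `{50, 51}`.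

## References
* [Ribet1983] K. A. Ribet, Amer. J. Math. 105 (1983), Thm. 0 and Thm. 3.
* [Gordon1997] B. B. Gordon, *A survey of the Hodge conjecture for abelian varieties*, Thm. 6.3 (3) and Corollary.
* [MoonenZarhin1999LowDim] B. Moonen, Yu. Zarhin, Math. Ann. 315 (1999), §2 (2.4), Thm. (2.7).
* [Deligne2000] P. Deligne, *The Hodge conjecture* (Clay, 2000), §1.
-/

noncomputable section

open CategoryTheory Module

namespace Literature.AlgebraicGeometry.HodgeTheory

open Literature.AlgebraicGeometry.Motives
open Literature.AlgebraicGeometry.Motives.HodgeStructure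

section Cells

/-- **Ribet 1983 Thm. 3 at `(n′, n″) = (12, 89)` — UNCONDITIONAL** (core `UnitaryTwelveEightyNine.eq_top_of_smul`).
[cite: Ribet1983, Thm. 0 and Thm. 3] [cite: Gordon1997, Thm. 6.3 (3) and Corollary] -/
theorem AbelianVariety.isDivisorGenerated_powSucc_of_ribetTypeTwelveEightyNine (A : AbelianVariety ℂ) (φ : A ⟶ A)
    {d : ℕ} (hd : 0 < d) (hφ : φ ≫ φ = -(d • 𝟙 A)) (hE2 : Module.finrank ℚ A.endAlgebra = 2)
    (h12 : eigenMultiplicity A φ (Complex.I * (Real.sqrt d : ℂ)) = 12)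
    (h89 : eigenMultiplicity A φ (-(Complex.I * (Real.sqrt d : ℂ))) = 89) (N : ℕ) :
    IsDivisorGenerated (A.powSucc N) := by
  refine AbelianVariety.isDivisorGenerated_powSucc_of_ribetType_ofCoreSmul A φ hd hφ hE2 (by omega) (by omega) ?_ N
  intro W' _ _ _ 𝔊 ι P' Q' s hbr hirr hι hιι hP' hQ' hfinP' hfinQ' hadd hsmul hsymm hPQ hdefP hdefQ hadj
  exact UnitaryTwelveEightyNine.eq_top_of_smul hbr hirr hι hιι hP' hQ' (by rw [hfinP', h12]) (by rw [hfinQ', h89]) hadd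
    hsmul hsymm hPQ hdefP hdefQ hadj

/-- The mirror: `n_{i√d}(φ) = 89`, `n_{−i√d}(φ) = 12` (core `UnitaryTwelveEightyNine.eq_top_of_smul'`).
[cite: Ribet1983, Thm. 0 and Thm. 3] [cite: Gordon1997, Thm. 6.3 (3) and Corollary] -/
theorem AbelianVariety.isDivisorGenerated_powSucc_of_ribetTypeTwelveEightyNine' (A : AbelianVariety ℂ) (φ : A ⟶ A)
    {d : ℕ} (hd : 0 < d) (hφ : φ ≫ φ = -(d • 𝟙 A)) (hE2 : Module.finrank ℚ A.endAlgebra = 2)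
    (h89 : eigenMultiplicity A φ (Complex.I * (Real.sqrt d : ℂ)) = 89)
    (h12 : eigenMultiplicity A φ (-(Complex.I * (Real.sqrt d : ℂ))) = 12) (N : ℕ) :
    IsDivisorGenerated (A.powSucc N) := by
  refine AbelianVariety.isDivisorGenerated_powSucc_of_ribetType_ofCoreSmul A φ hd hφ hE2 (by omega) (by omega) ?_ N
  intro W' _ _ _ 𝔊 ι P' Q' s hbr hirr hι hιι hP' hQ' hfinP' hfinQ' hadd hsmul hsymm hPQ hdefP hdefQ hadj
  exact UnitaryTwelveEightyNine.eq_top_of_smul' hbr hirr hι hιι hP' hQ' (by rw [hfinP', h89]) (by rw [hfinQ', h12])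
    hadd hsmul hsymm hPQ hdefP hdefQ hadj

/-- **The Hodge conjecture for all powers `A^{N+1}` of an abelian variety of Ribet type `(12, 89)` — UNCONDITIONAL.**
[cite: Ribet1983, Thm. 3] [cite: Deligne2000, §1] -/
theorem hodgeConjectureFor_powSucc_of_ribetTypeTwelveEightyNine (A : AbelianVariety ℂ) (φ : A ⟶ A)
    {d : ℕ} (hd : 0 < d) (hφ : φ ≫ φ = -(d • 𝟙 A)) (hE2 : Module.finrank ℚ A.endAlgebra = 2)
    (h12 : eigenMultiplicity A φ (Complex.I * (Real.sqrt d : ℂ)) = 12)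
    (h89 : eigenMultiplicity A φ (-(Complex.I * (Real.sqrt d : ℂ))) = 89) (N : ℕ) :
    HodgeConjectureFor (A.powSucc N).dim (A.powSucc N).X :=
  hodgeConjectureFor_of_isDivisorGenerated _
    (AbelianVariety.isDivisorGenerated_powSucc_of_ribetTypeTwelveEightyNine A φ hd hφ hE2 h12 h89 N)

/-- **101-FOLDS of signature `{12, 89}`: `B• = D•` on all powers — UNCONDITIONAL** (either eigenvalue may carry the `12`).
[cite: Ribet1983, Thm. 0 and Thm. 3] [cite: MoonenZarhin1999LowDim, §2 (2.4)] -/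
theorem AbelianVariety.isDivisorGenerated_powSucc_of_onehundredonefold_twelveEightyNine (A : AbelianVariety ℂ)
    (φ : A ⟶ A) {d : ℕ} (hd : 0 < d) (hφ : φ ≫ φ = -(d • 𝟙 A)) (hE2 : Module.finrank ℚ A.endAlgebra = 2)
    (hX : A.dim = 101)
    (h12 : eigenMultiplicity A φ (Complex.I * (Real.sqrt d : ℂ)) = 12 ∨
      eigenMultiplicity A φ (-(Complex.I * (Real.sqrt d : ℂ))) = 12)
    (N : ℕ) : IsDivisorGenerated (A.powSucc N) := by
  have hsum := eigenMultiplicity_add_eigenMultiplicity_neg_eq_dim A φ hd hφ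
  rw [hX] at hsum
  rcases h12 with h | h
  · exact AbelianVariety.isDivisorGenerated_powSucc_of_ribetTypeTwelveEightyNine A φ hd hφ hE2 h (by omega) N
  · exact AbelianVariety.isDivisorGenerated_powSucc_of_ribetTypeTwelveEightyNine' A φ hd hφ hE2 (by omega) h N

/-- **The Hodge conjecture for all powers of a 101-FOLD of signature `{12, 89}` — UNCONDITIONAL.**
[cite: Ribet1983, Thm. 3] [cite: Deligne2000, §1] -/
theorem hodgeConjectureFor_powSucc_of_onehundredonefold_twelveEightyNine (A : AbelianVariety ℂ)
    (φ : A ⟶ A) {d : ℕ} (hd : 0 < d) (hφ : φ ≫ φ = -(d • 𝟙 A)) (hE2 : Module.finrank ℚ A.endAlgebra = 2)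
    (hX : A.dim = 101)
    (h12 : eigenMultiplicity A φ (Complex.I * (Real.sqrt d : ℂ)) = 12 ∨
      eigenMultiplicity A φ (-(Complex.I * (Real.sqrt d : ℂ))) = 12)
    (N : ℕ) : HodgeConjectureFor (A.powSucc N).dim (A.powSucc N).X :=
  hodgeConjectureFor_of_isDivisorGenerated _
    (AbelianVariety.isDivisorGenerated_powSucc_of_onehundredonefold_twelveEightyNine A φ hd hφ hE2 hX h12 N)

/-- **Ribet 1983 Thm. 3 at `(n′, n″) = (18, 83)` — UNCONDITIONAL** (core `UnitaryEighteenEightyThree.eq_top_of_smul`).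
[cite: Ribet1983, Thm. 0 and Thm. 3] [cite: Gordon1997, Thm. 6.3 (3) and Corollary] -/
theorem AbelianVariety.isDivisorGenerated_powSucc_of_ribetTypeEighteenEightyThree (A : AbelianVariety ℂ) (φ : A ⟶ A)
    {d : ℕ} (hd : 0 < d) (hφ : φ ≫ φ = -(d • 𝟙 A)) (hE2 : Module.finrank ℚ A.endAlgebra = 2)
    (h18 : eigenMultiplicity A φ (Complex.I * (Real.sqrt d : ℂ)) = 18)
    (h83 : eigenMultiplicity A φ (-(Complex.I * (Real.sqrt d : ℂ))) = 83) (N : ℕ) :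
    IsDivisorGenerated (A.powSucc N) := by
  refine AbelianVariety.isDivisorGenerated_powSucc_of_ribetType_ofCoreSmul A φ hd hφ hE2 (by omega) (by omega) ?_ N
  intro W' _ _ _ 𝔊 ι P' Q' s hbr hirr hι hιι hP' hQ' hfinP' hfinQ' hadd hsmul hsymm hPQ hdefP hdefQ hadj
  exact UnitaryEighteenEightyThree.eq_top_of_smul hbr hirr hι hιι hP' hQ' (by rw [hfinP', h18]) (by rw [hfinQ', h83]) hadd
    hsmul hsymm hPQ hdefP hdefQ hadj

/-- The mirror: `n_{i√d}(φ) = 83`, `n_{−i√d}(φ) = 18` (core `UnitaryEighteenEightyThree.eq_top_of_smul'`).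
[cite: Ribet1983, Thm. 0 and Thm. 3] [cite: Gordon1997, Thm. 6.3 (3) and Corollary] -/
theorem AbelianVariety.isDivisorGenerated_powSucc_of_ribetTypeEighteenEightyThree' (A : AbelianVariety ℂ) (φ : A ⟶ A)
    {d : ℕ} (hd : 0 < d) (hφ : φ ≫ φ = -(d • 𝟙 A)) (hE2 : Module.finrank ℚ A.endAlgebra = 2)
    (h83 : eigenMultiplicity A φ (Complex.I * (Real.sqrt d : ℂ)) = 83)
    (h18 : eigenMultiplicity A φ (-(Complex.I * (Real.sqrt d : ℂ))) = 18) (N : ℕ) :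
    IsDivisorGenerated (A.powSucc N) := by
  refine AbelianVariety.isDivisorGenerated_powSucc_of_ribetType_ofCoreSmul A φ hd hφ hE2 (by omega) (by omega) ?_ N
  intro W' _ _ _ 𝔊 ι P' Q' s hbr hirr hι hιι hP' hQ' hfinP' hfinQ' hadd hsmul hsymm hPQ hdefP hdefQ hadj
  exact UnitaryEighteenEightyThree.eq_top_of_smul' hbr hirr hι hιι hP' hQ' (by rw [hfinP', h83]) (by rw [hfinQ', h18])
    hadd hsmul hsymm hPQ hdefP hdefQ hadj

/-- **The Hodge conjecture for all powers `A^{N+1}` of an abelian variety of Ribet type `(18, 83)` — UNCONDITIONAL.**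
[cite: Ribet1983, Thm. 3] [cite: Deligne2000, §1] -/
theorem hodgeConjectureFor_powSucc_of_ribetTypeEighteenEightyThree (A : AbelianVariety ℂ) (φ : A ⟶ A)
    {d : ℕ} (hd : 0 < d) (hφ : φ ≫ φ = -(d • 𝟙 A)) (hE2 : Module.finrank ℚ A.endAlgebra = 2)
    (h18 : eigenMultiplicity A φ (Complex.I * (Real.sqrt d : ℂ)) = 18)
    (h83 : eigenMultiplicity A φ (-(Complex.I * (Real.sqrt d : ℂ))) = 83) (N : ℕ) :
    HodgeConjectureFor (A.powSucc N).dim (A.powSucc N).X :=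
  hodgeConjectureFor_of_isDivisorGenerated _
    (AbelianVariety.isDivisorGenerated_powSucc_of_ribetTypeEighteenEightyThree A φ hd hφ hE2 h18 h83 N)

/-- **101-FOLDS of signature `{18, 83}`: `B• = D•` on all powers — UNCONDITIONAL** (either eigenvalue may carry the `18`).
[cite: Ribet1983, Thm. 0 and Thm. 3] [cite: MoonenZarhin1999LowDim, §2 (2.4)] -/
theorem AbelianVariety.isDivisorGenerated_powSucc_of_onehundredonefold_eighteenEightyThree (A : AbelianVariety ℂ)
    (φ : A ⟶ A) {d : ℕ} (hd : 0 < d) (hφ : φ ≫ φ = -(d • 𝟙 A)) (hE2 : Module.finrank ℚ A.endAlgebra = 2)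
    (hX : A.dim = 101)
    (h18 : eigenMultiplicity A φ (Complex.I * (Real.sqrt d : ℂ)) = 18 ∨
      eigenMultiplicity A φ (-(Complex.I * (Real.sqrt d : ℂ))) = 18)
    (N : ℕ) : IsDivisorGenerated (A.powSucc N) := by
  have hsum := eigenMultiplicity_add_eigenMultiplicity_neg_eq_dim A φ hd hφ
  rw [hX] at hsum
  rcases h18 with h | h
  · exact AbelianVariety.isDivisorGenerated_powSucc_of_ribetTypeEighteenEightyThree A φ hd hφ hE2 h (by omega) N
  · exact AbelianVariety.isDivisorGenerated_powSucc_of_ribetTypeEighteenEightyThree' A φ hd hφ hE2 (by omega) h N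

/-- **The Hodge conjecture for all powers of a 101-FOLD of signature `{18, 83}` — UNCONDITIONAL.**
[cite: Ribet1983, Thm. 3] [cite: Deligne2000, §1] -/
theorem hodgeConjectureFor_powSucc_of_onehundredonefold_eighteenEightyThree (A : AbelianVariety ℂ)
    (φ : A ⟶ A) {d : ℕ} (hd : 0 < d) (hφ : φ ≫ φ = -(d • 𝟙 A)) (hE2 : Module.finrank ℚ A.endAlgebra = 2)
    (hX : A.dim = 101)
    (h18 : eigenMultiplicity A φ (Complex.I * (Real.sqrt d : ℂ)) = 18 ∨
      eigenMultiplicity A φ (-(Complex.I * (Real.sqrt d : ℂ))) = 18)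
    (N : ℕ) : HodgeConjectureFor (A.powSucc N).dim (A.powSucc N).X :=
  hodgeConjectureFor_of_isDivisorGenerated _
    (AbelianVariety.isDivisorGenerated_powSucc_of_onehundredonefold_eighteenEightyThree A φ hd hφ hE2 hX h18 N)

/-- **Ribet 1983 Thm. 3 at `(n′, n″) = (22, 79)` — UNCONDITIONAL** (core `UnitaryTwentyTwoSeventyNine.eq_top_of_smul`).
[cite: Ribet1983, Thm. 0 and Thm. 3] [cite: Gordon1997, Thm. 6.3 (3) and Corollary] -/
theorem AbelianVariety.isDivisorGenerated_powSucc_of_ribetTypeTwentyTwoSeventyNine (A : AbelianVariety ℂ) (φ : A ⟶ A)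
    {d : ℕ} (hd : 0 < d) (hφ : φ ≫ φ = -(d • 𝟙 A)) (hE2 : Module.finrank ℚ A.endAlgebra = 2)
    (h22 : eigenMultiplicity A φ (Complex.I * (Real.sqrt d : ℂ)) = 22)
    (h79 : eigenMultiplicity A φ (-(Complex.I * (Real.sqrt d : ℂ))) = 79) (N : ℕ) :
    IsDivisorGenerated (A.powSucc N) := by
  refine AbelianVariety.isDivisorGenerated_powSucc_of_ribetType_ofCoreSmul A φ hd hφ hE2 (by omega) (by omega) ?_ N
  intro W' _ _ _ 𝔊 ι P' Q' s hbr hirr hι hιι hP' hQ' hfinP' hfinQ' hadd hsmul hsymm hPQ hdefP hdefQ hadj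
  exact UnitaryTwentyTwoSeventyNine.eq_top_of_smul hbr hirr hι hιι hP' hQ' (by rw [hfinP', h22]) (by rw [hfinQ', h79]) hadd
    hsmul hsymm hPQ hdefP hdefQ hadj

/-- The mirror: `n_{i√d}(φ) = 79`, `n_{−i√d}(φ) = 22` (core `UnitaryTwentyTwoSeventyNine.eq_top_of_smul'`).
[cite: Ribet1983, Thm. 0 and Thm. 3] [cite: Gordon1997, Thm. 6.3 (3) and Corollary] -/
theorem AbelianVariety.isDivisorGenerated_powSucc_of_ribetTypeTwentyTwoSeventyNine' (A : AbelianVariety ℂ) (φ : A ⟶ A)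
    {d : ℕ} (hd : 0 < d) (hφ : φ ≫ φ = -(d • 𝟙 A)) (hE2 : Module.finrank ℚ A.endAlgebra = 2)
    (h79 : eigenMultiplicity A φ (Complex.I * (Real.sqrt d : ℂ)) = 79)
    (h22 : eigenMultiplicity A φ (-(Complex.I * (Real.sqrt d : ℂ))) = 22) (N : ℕ) :
    IsDivisorGenerated (A.powSucc N) := by
  refine AbelianVariety.isDivisorGenerated_powSucc_of_ribetType_ofCoreSmul A φ hd hφ hE2 (by omega) (by omega) ?_ N
  intro W' _ _ _ 𝔊 ι P' Q' s hbr hirr hι hιι hP' hQ' hfinP' hfinQ' hadd hsmul hsymm hPQ hdefP hdefQ hadj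
  exact UnitaryTwentyTwoSeventyNine.eq_top_of_smul' hbr hirr hι hιι hP' hQ' (by rw [hfinP', h79]) (by rw [hfinQ', h22])
    hadd hsmul hsymm hPQ hdefP hdefQ hadj

/-- **The Hodge conjecture for all powers `A^{N+1}` of an abelian variety of Ribet type `(22, 79)` — UNCONDITIONAL.**
[cite: Ribet1983, Thm. 3] [cite: Deligne2000, §1] -/
theorem hodgeConjectureFor_powSucc_of_ribetTypeTwentyTwoSeventyNine (A : AbelianVariety ℂ) (φ : A ⟶ A)
    {d : ℕ} (hd : 0 < d) (hφ : φ ≫ φ = -(d • 𝟙 A)) (hE2 : Module.finrank ℚ A.endAlgebra = 2)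
    (h22 : eigenMultiplicity A φ (Complex.I * (Real.sqrt d : ℂ)) = 22)
    (h79 : eigenMultiplicity A φ (-(Complex.I * (Real.sqrt d : ℂ))) = 79) (N : ℕ) :
    HodgeConjectureFor (A.powSucc N).dim (A.powSucc N).X :=
  hodgeConjectureFor_of_isDivisorGenerated _
    (AbelianVariety.isDivisorGenerated_powSucc_of_ribetTypeTwentyTwoSeventyNine A φ hd hφ hE2 h22 h79 N)

/-- **101-FOLDS of signature `{22, 79}`: `B• = D•` on all powers — UNCONDITIONAL** (either eigenvalue may carry the `22`).
[cite: Ribet1983, Thm. 0 and Thm. 3] [cite: MoonenZarhin1999LowDim, §2 (2.4)] -/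
theorem AbelianVariety.isDivisorGenerated_powSucc_of_onehundredonefold_twentyTwoSeventyNine (A : AbelianVariety ℂ)
    (φ : A ⟶ A) {d : ℕ} (hd : 0 < d) (hφ : φ ≫ φ = -(d • 𝟙 A)) (hE2 : Module.finrank ℚ A.endAlgebra = 2)
    (hX : A.dim = 101)
    (h22 : eigenMultiplicity A φ (Complex.I * (Real.sqrt d : ℂ)) = 22 ∨
      eigenMultiplicity A φ (-(Complex.I * (Real.sqrt d : ℂ))) = 22)
    (N : ℕ) : IsDivisorGenerated (A.powSucc N) := by
  have hsum := eigenMultiplicity_add_eigenMultiplicity_neg_eq_dim A φ hd hφ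
  rw [hX] at hsum
  rcases h22 with h | h
  · exact AbelianVariety.isDivisorGenerated_powSucc_of_ribetTypeTwentyTwoSeventyNine A φ hd hφ hE2 h (by omega) N
  · exact AbelianVariety.isDivisorGenerated_powSucc_of_ribetTypeTwentyTwoSeventyNine' A φ hd hφ hE2 (by omega) h N

/-- **The Hodge conjecture for all powers of a 101-FOLD of signature `{22, 79}` — UNCONDITIONAL.**
[cite: Ribet1983, Thm. 3] [cite: Deligne2000, §1] -/
theorem hodgeConjectureFor_powSucc_of_onehundredonefold_twentyTwoSeventyNine (A : AbelianVariety ℂ)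
    (φ : A ⟶ A) {d : ℕ} (hd : 0 < d) (hφ : φ ≫ φ = -(d • 𝟙 A)) (hE2 : Module.finrank ℚ A.endAlgebra = 2)
    (hX : A.dim = 101)
    (h22 : eigenMultiplicity A φ (Complex.I * (Real.sqrt d : ℂ)) = 22 ∨
      eigenMultiplicity A φ (-(Complex.I * (Real.sqrt d : ℂ))) = 22)
    (N : ℕ) : HodgeConjectureFor (A.powSucc N).dim (A.powSucc N).X :=
  hodgeConjectureFor_of_isDivisorGenerated _
    (AbelianVariety.isDivisorGenerated_powSucc_of_onehundredonefold_twentyTwoSeventyNine A φ hd hφ hE2 hX h22 N)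

/-- **Ribet 1983 Thm. 3 at `(n′, n″) = (28, 73)` — UNCONDITIONAL** (core `UnitaryTwentyEightSeventyThree.eq_top_of_smul`).
[cite: Ribet1983, Thm. 0 and Thm. 3] [cite: Gordon1997, Thm. 6.3 (3) and Corollary] -/
theorem AbelianVariety.isDivisorGenerated_powSucc_of_ribetTypeTwentyEightSeventyThree (A : AbelianVariety ℂ) (φ : A ⟶ A)
    {d : ℕ} (hd : 0 < d) (hφ : φ ≫ φ = -(d • 𝟙 A)) (hE2 : Module.finrank ℚ A.endAlgebra = 2)
    (h28 : eigenMultiplicity A φ (Complex.I * (Real.sqrt d : ℂ)) = 28)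
    (h73 : eigenMultiplicity A φ (-(Complex.I * (Real.sqrt d : ℂ))) = 73) (N : ℕ) :
    IsDivisorGenerated (A.powSucc N) := by
  refine AbelianVariety.isDivisorGenerated_powSucc_of_ribetType_ofCoreSmul A φ hd hφ hE2 (by omega) (by omega) ?_ N
  intro W' _ _ _ 𝔊 ι P' Q' s hbr hirr hι hιι hP' hQ' hfinP' hfinQ' hadd hsmul hsymm hPQ hdefP hdefQ hadj
  exact UnitaryTwentyEightSeventyThree.eq_top_of_smul hbr hirr hι hιι hP' hQ' (by rw [hfinP', h28]) (by rw [hfinQ', h73]) hadd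
    hsmul hsymm hPQ hdefP hdefQ hadj

/-- The mirror: `n_{i√d}(φ) = 73`, `n_{−i√d}(φ) = 28` (core `UnitaryTwentyEightSeventyThree.eq_top_of_smul'`).
[cite: Ribet1983, Thm. 0 and Thm. 3] [cite: Gordon1997, Thm. 6.3 (3) and Corollary] -/
theorem AbelianVariety.isDivisorGenerated_powSucc_of_ribetTypeTwentyEightSeventyThree' (A : AbelianVariety ℂ) (φ : A ⟶ A)
    {d : ℕ} (hd : 0 < d) (hφ : φ ≫ φ = -(d • 𝟙 A)) (hE2 : Module.finrank ℚ A.endAlgebra = 2)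
    (h73 : eigenMultiplicity A φ (Complex.I * (Real.sqrt d : ℂ)) = 73)
    (h28 : eigenMultiplicity A φ (-(Complex.I * (Real.sqrt d : ℂ))) = 28) (N : ℕ) :
    IsDivisorGenerated (A.powSucc N) := by
  refine AbelianVariety.isDivisorGenerated_powSucc_of_ribetType_ofCoreSmul A φ hd hφ hE2 (by omega) (by omega) ?_ N
  intro W' _ _ _ 𝔊 ι P' Q' s hbr hirr hι hιι hP' hQ' hfinP' hfinQ' hadd hsmul hsymm hPQ hdefP hdefQ hadj
  exact UnitaryTwentyEightSeventyThree.eq_top_of_smul' hbr hirr hι hιι hP' hQ' (by rw [hfinP', h73]) (by rw [hfinQ', h28])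
    hadd hsmul hsymm hPQ hdefP hdefQ hadj

/-- **The Hodge conjecture for all powers `A^{N+1}` of an abelian variety of Ribet type `(28, 73)` — UNCONDITIONAL.**
[cite: Ribet1983, Thm. 3] [cite: Deligne2000, §1] -/
theorem hodgeConjectureFor_powSucc_of_ribetTypeTwentyEightSeventyThree (A : AbelianVariety ℂ) (φ : A ⟶ A)
    {d : ℕ} (hd : 0 < d) (hφ : φ ≫ φ = -(d • 𝟙 A)) (hE2 : Module.finrank ℚ A.endAlgebra = 2)
    (h28 : eigenMultiplicity A φ (Complex.I * (Real.sqrt d : ℂ)) = 28)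
    (h73 : eigenMultiplicity A φ (-(Complex.I * (Real.sqrt d : ℂ))) = 73) (N : ℕ) :
    HodgeConjectureFor (A.powSucc N).dim (A.powSucc N).X :=
  hodgeConjectureFor_of_isDivisorGenerated _
    (AbelianVariety.isDivisorGenerated_powSucc_of_ribetTypeTwentyEightSeventyThree A φ hd hφ hE2 h28 h73 N)

/-- **101-FOLDS of signature `{28, 73}`: `B• = D•` on all powers — UNCONDITIONAL** (either eigenvalue may carry the `28`).
[cite: Ribet1983, Thm. 0 and Thm. 3] [cite: MoonenZarhin1999LowDim, §2 (2.4)] -/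
theorem AbelianVariety.isDivisorGenerated_powSucc_of_onehundredonefold_twentyEightSeventyThree (A : AbelianVariety ℂ)
    (φ : A ⟶ A) {d : ℕ} (hd : 0 < d) (hφ : φ ≫ φ = -(d • 𝟙 A)) (hE2 : Module.finrank ℚ A.endAlgebra = 2)
    (hX : A.dim = 101)
    (h28 : eigenMultiplicity A φ (Complex.I * (Real.sqrt d : ℂ)) = 28 ∨
      eigenMultiplicity A φ (-(Complex.I * (Real.sqrt d : ℂ))) = 28)
    (N : ℕ) : IsDivisorGenerated (A.powSucc N) := by
  have hsum := eigenMultiplicity_add_eigenMultiplicity_neg_eq_dim A φ hd hφ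
  rw [hX] at hsum
  rcases h28 with h | h
  · exact AbelianVariety.isDivisorGenerated_powSucc_of_ribetTypeTwentyEightSeventyThree A φ hd hφ hE2 h (by omega) N
  · exact AbelianVariety.isDivisorGenerated_powSucc_of_ribetTypeTwentyEightSeventyThree' A φ hd hφ hE2 (by omega) h N

/-- **The Hodge conjecture for all powers of a 101-FOLD of signature `{28, 73}` — UNCONDITIONAL.**
[cite: Ribet1983, Thm. 3] [cite: Deligne2000, §1] -/
theorem hodgeConjectureFor_powSucc_of_onehundredonefold_twentyEightSeventyThree (A : AbelianVariety ℂ)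
    (φ : A ⟶ A) {d : ℕ} (hd : 0 < d) (hφ : φ ≫ φ = -(d • 𝟙 A)) (hE2 : Module.finrank ℚ A.endAlgebra = 2)
    (hX : A.dim = 101)
    (h28 : eigenMultiplicity A φ (Complex.I * (Real.sqrt d : ℂ)) = 28 ∨
      eigenMultiplicity A φ (-(Complex.I * (Real.sqrt d : ℂ))) = 28)
    (N : ℕ) : HodgeConjectureFor (A.powSucc N).dim (A.powSucc N).X :=
  hodgeConjectureFor_of_isDivisorGenerated _
    (AbelianVariety.isDivisorGenerated_powSucc_of_onehundredonefold_twentyEightSeventyThree A φ hd hφ hE2 hX h28 N)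

/-- **Ribet 1983 Thm. 3 at `(n′, n″) = (30, 71)` — UNCONDITIONAL** (core `UnitaryThirtySeventyOne.eq_top_of_smul`).
[cite: Ribet1983, Thm. 0 and Thm. 3] [cite: Gordon1997, Thm. 6.3 (3) and Corollary] -/
theorem AbelianVariety.isDivisorGenerated_powSucc_of_ribetTypeThirtySeventyOne (A : AbelianVariety ℂ) (φ : A ⟶ A)
    {d : ℕ} (hd : 0 < d) (hφ : φ ≫ φ = -(d • 𝟙 A)) (hE2 : Module.finrank ℚ A.endAlgebra = 2)
    (h30 : eigenMultiplicity A φ (Complex.I * (Real.sqrt d : ℂ)) = 30)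
    (h71 : eigenMultiplicity A φ (-(Complex.I * (Real.sqrt d : ℂ))) = 71) (N : ℕ) :
    IsDivisorGenerated (A.powSucc N) := by
  refine AbelianVariety.isDivisorGenerated_powSucc_of_ribetType_ofCoreSmul A φ hd hφ hE2 (by omega) (by omega) ?_ N
  intro W' _ _ _ 𝔊 ι P' Q' s hbr hirr hι hιι hP' hQ' hfinP' hfinQ' hadd hsmul hsymm hPQ hdefP hdefQ hadj
  exact UnitaryThirtySeventyOne.eq_top_of_smul hbr hirr hι hιι hP' hQ' (by rw [hfinP', h30]) (by rw [hfinQ', h71]) hadd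
    hsmul hsymm hPQ hdefP hdefQ hadj

/-- The mirror: `n_{i√d}(φ) = 71`, `n_{−i√d}(φ) = 30` (core `UnitaryThirtySeventyOne.eq_top_of_smul'`).
[cite: Ribet1983, Thm. 0 and Thm. 3] [cite: Gordon1997, Thm. 6.3 (3) and Corollary] -/
theorem AbelianVariety.isDivisorGenerated_powSucc_of_ribetTypeThirtySeventyOne' (A : AbelianVariety ℂ) (φ : A ⟶ A)
    {d : ℕ} (hd : 0 < d) (hφ : φ ≫ φ = -(d • 𝟙 A)) (hE2 : Module.finrank ℚ A.endAlgebra = 2)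
    (h71 : eigenMultiplicity A φ (Complex.I * (Real.sqrt d : ℂ)) = 71)
    (h30 : eigenMultiplicity A φ (-(Complex.I * (Real.sqrt d : ℂ))) = 30) (N : ℕ) :
    IsDivisorGenerated (A.powSucc N) := by
  refine AbelianVariety.isDivisorGenerated_powSucc_of_ribetType_ofCoreSmul A φ hd hφ hE2 (by omega) (by omega) ?_ N
  intro W' _ _ _ 𝔊 ι P' Q' s hbr hirr hι hιι hP' hQ' hfinP' hfinQ' hadd hsmul hsymm hPQ hdefP hdefQ hadj
  exact UnitaryThirtySeventyOne.eq_top_of_smul' hbr hirr hι hιι hP' hQ' (by rw [hfinP', h71]) (by rw [hfinQ', h30])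
    hadd hsmul hsymm hPQ hdefP hdefQ hadj

/-- **The Hodge conjecture for all powers `A^{N+1}` of an abelian variety of Ribet type `(30, 71)` — UNCONDITIONAL.**
[cite: Ribet1983, Thm. 3] [cite: Deligne2000, §1] -/
theorem hodgeConjectureFor_powSucc_of_ribetTypeThirtySeventyOne (A : AbelianVariety ℂ) (φ : A ⟶ A)
    {d : ℕ} (hd : 0 < d) (hφ : φ ≫ φ = -(d • 𝟙 A)) (hE2 : Module.finrank ℚ A.endAlgebra = 2)
    (h30 : eigenMultiplicity A φ (Complex.I * (Real.sqrt d : ℂ)) = 30)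
    (h71 : eigenMultiplicity A φ (-(Complex.I * (Real.sqrt d : ℂ))) = 71) (N : ℕ) :
    HodgeConjectureFor (A.powSucc N).dim (A.powSucc N).X :=
  hodgeConjectureFor_of_isDivisorGenerated _
    (AbelianVariety.isDivisorGenerated_powSucc_of_ribetTypeThirtySeventyOne A φ hd hφ hE2 h30 h71 N)

/-- **101-FOLDS of signature `{30, 71}`: `B• = D•` on all powers — UNCONDITIONAL** (either eigenvalue may carry the `30`).
[cite: Ribet1983, Thm. 0 and Thm. 3] [cite: MoonenZarhin1999LowDim, §2 (2.4)] -/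
theorem AbelianVariety.isDivisorGenerated_powSucc_of_onehundredonefold_thirtySeventyOne (A : AbelianVariety ℂ)
    (φ : A ⟶ A) {d : ℕ} (hd : 0 < d) (hφ : φ ≫ φ = -(d • 𝟙 A)) (hE2 : Module.finrank ℚ A.endAlgebra = 2)
    (hX : A.dim = 101)
    (h30 : eigenMultiplicity A φ (Complex.I * (Real.sqrt d : ℂ)) = 30 ∨
      eigenMultiplicity A φ (-(Complex.I * (Real.sqrt d : ℂ))) = 30)
    (N : ℕ) : IsDivisorGenerated (A.powSucc N) := by
  have hsum := eigenMultiplicity_add_eigenMultiplicity_neg_eq_dim A φ hd hφ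
  rw [hX] at hsum
  rcases h30 with h | h
  · exact AbelianVariety.isDivisorGenerated_powSucc_of_ribetTypeThirtySeventyOne A φ hd hφ hE2 h (by omega) N
  · exact AbelianVariety.isDivisorGenerated_powSucc_of_ribetTypeThirtySeventyOne' A φ hd hφ hE2 (by omega) h N

/-- **The Hodge conjecture for all powers of a 101-FOLD of signature `{30, 71}` — UNCONDITIONAL.**
[cite: Ribet1983, Thm. 3] [cite: Deligne2000, §1] -/
theorem hodgeConjectureFor_powSucc_of_onehundredonefold_thirtySeventyOne (A : AbelianVariety ℂ)
    (φ : A ⟶ A) {d : ℕ} (hd : 0 < d) (hφ : φ ≫ φ = -(d • 𝟙 A)) (hE2 : Module.finrank ℚ A.endAlgebra = 2)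
    (hX : A.dim = 101)
    (h30 : eigenMultiplicity A φ (Complex.I * (Real.sqrt d : ℂ)) = 30 ∨
      eigenMultiplicity A φ (-(Complex.I * (Real.sqrt d : ℂ))) = 30)
    (N : ℕ) : HodgeConjectureFor (A.powSucc N).dim (A.powSucc N).X :=
  hodgeConjectureFor_of_isDivisorGenerated _
    (AbelianVariety.isDivisorGenerated_powSucc_of_onehundredonefold_thirtySeventyOne A φ hd hφ hE2 hX h30 N)

/-- **Ribet 1983 Thm. 3 at `(n′, n″) = (34, 67)` — UNCONDITIONAL** (core `UnitaryThirtyFourSixtySeven.eq_top_of_smul`).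
[cite: Ribet1983, Thm. 0 and Thm. 3] [cite: Gordon1997, Thm. 6.3 (3) and Corollary] -/
theorem AbelianVariety.isDivisorGenerated_powSucc_of_ribetTypeThirtyFourSixtySeven (A : AbelianVariety ℂ) (φ : A ⟶ A)
    {d : ℕ} (hd : 0 < d) (hφ : φ ≫ φ = -(d • 𝟙 A)) (hE2 : Module.finrank ℚ A.endAlgebra = 2)
    (h34 : eigenMultiplicity A φ (Complex.I * (Real.sqrt d : ℂ)) = 34)
    (h67 : eigenMultiplicity A φ (-(Complex.I * (Real.sqrt d : ℂ))) = 67) (N : ℕ) :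
    IsDivisorGenerated (A.powSucc N) := by
  refine AbelianVariety.isDivisorGenerated_powSucc_of_ribetType_ofCoreSmul A φ hd hφ hE2 (by omega) (by omega) ?_ N
  intro W' _ _ _ 𝔊 ι P' Q' s hbr hirr hι hιι hP' hQ' hfinP' hfinQ' hadd hsmul hsymm hPQ hdefP hdefQ hadj
  exact UnitaryThirtyFourSixtySeven.eq_top_of_smul hbr hirr hι hιι hP' hQ' (by rw [hfinP', h34]) (by rw [hfinQ', h67]) hadd
    hsmul hsymm hPQ hdefP hdefQ hadj

/-- The mirror: `n_{i√d}(φ) = 67`, `n_{−i√d}(φ) = 34` (core `UnitaryThirtyFourSixtySeven.eq_top_of_smul'`).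
[cite: Ribet1983, Thm. 0 and Thm. 3] [cite: Gordon1997, Thm. 6.3 (3) and Corollary] -/
theorem AbelianVariety.isDivisorGenerated_powSucc_of_ribetTypeThirtyFourSixtySeven' (A : AbelianVariety ℂ) (φ : A ⟶ A)
    {d : ℕ} (hd : 0 < d) (hφ : φ ≫ φ = -(d • 𝟙 A)) (hE2 : Module.finrank ℚ A.endAlgebra = 2)
    (h67 : eigenMultiplicity A φ (Complex.I * (Real.sqrt d : ℂ)) = 67)
    (h34 : eigenMultiplicity A φ (-(Complex.I * (Real.sqrt d : ℂ))) = 34) (N : ℕ) :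
    IsDivisorGenerated (A.powSucc N) := by
  refine AbelianVariety.isDivisorGenerated_powSucc_of_ribetType_ofCoreSmul A φ hd hφ hE2 (by omega) (by omega) ?_ N
  intro W' _ _ _ 𝔊 ι P' Q' s hbr hirr hι hιι hP' hQ' hfinP' hfinQ' hadd hsmul hsymm hPQ hdefP hdefQ hadj
  exact UnitaryThirtyFourSixtySeven.eq_top_of_smul' hbr hirr hι hιι hP' hQ' (by rw [hfinP', h67]) (by rw [hfinQ', h34])
    hadd hsmul hsymm hPQ hdefP hdefQ hadj

/-- **The Hodge conjecture for all powers `A^{N+1}` of an abelian variety of Ribet type `(34, 67)` — UNCONDITIONAL.**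
[cite: Ribet1983, Thm. 3] [cite: Deligne2000, §1] -/
theorem hodgeConjectureFor_powSucc_of_ribetTypeThirtyFourSixtySeven (A : AbelianVariety ℂ) (φ : A ⟶ A)
    {d : ℕ} (hd : 0 < d) (hφ : φ ≫ φ = -(d • 𝟙 A)) (hE2 : Module.finrank ℚ A.endAlgebra = 2)
    (h34 : eigenMultiplicity A φ (Complex.I * (Real.sqrt d : ℂ)) = 34)
    (h67 : eigenMultiplicity A φ (-(Complex.I * (Real.sqrt d : ℂ))) = 67) (N : ℕ) :
    HodgeConjectureFor (A.powSucc N).dim (A.powSucc N).X :=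
  hodgeConjectureFor_of_isDivisorGenerated _
    (AbelianVariety.isDivisorGenerated_powSucc_of_ribetTypeThirtyFourSixtySeven A φ hd hφ hE2 h34 h67 N)

/-- **101-FOLDS of signature `{34, 67}`: `B• = D•` on all powers — UNCONDITIONAL** (either eigenvalue may carry the `34`).
[cite: Ribet1983, Thm. 0 and Thm. 3] [cite: MoonenZarhin1999LowDim, §2 (2.4)] -/
theorem AbelianVariety.isDivisorGenerated_powSucc_of_onehundredonefold_thirtyFourSixtySeven (A : AbelianVariety ℂ)
    (φ : A ⟶ A) {d : ℕ} (hd : 0 < d) (hφ : φ ≫ φ = -(d • 𝟙 A)) (hE2 : Module.finrank ℚ A.endAlgebra = 2)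
    (hX : A.dim = 101)
    (h34 : eigenMultiplicity A φ (Complex.I * (Real.sqrt d : ℂ)) = 34 ∨
      eigenMultiplicity A φ (-(Complex.I * (Real.sqrt d : ℂ))) = 34)
    (N : ℕ) : IsDivisorGenerated (A.powSucc N) := by
  have hsum := eigenMultiplicity_add_eigenMultiplicity_neg_eq_dim A φ hd hφ
  rw [hX] at hsum
  rcases h34 with h | h
  · exact AbelianVariety.isDivisorGenerated_powSucc_of_ribetTypeThirtyFourSixtySeven A φ hd hφ hE2 h (by omega) N
  · exact AbelianVariety.isDivisorGenerated_powSucc_of_ribetTypeThirtyFourSixtySeven' A φ hd hφ hE2 (by omega) h N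

/-- **The Hodge conjecture for all powers of a 101-FOLD of signature `{34, 67}` — UNCONDITIONAL.**
[cite: Ribet1983, Thm. 3] [cite: Deligne2000, §1] -/
theorem hodgeConjectureFor_powSucc_of_onehundredonefold_thirtyFourSixtySeven (A : AbelianVariety ℂ)
    (φ : A ⟶ A) {d : ℕ} (hd : 0 < d) (hφ : φ ≫ φ = -(d • 𝟙 A)) (hE2 : Module.finrank ℚ A.endAlgebra = 2)
    (hX : A.dim = 101)
    (h34 : eigenMultiplicity A φ (Complex.I * (Real.sqrt d : ℂ)) = 34 ∨
      eigenMultiplicity A φ (-(Complex.I * (Real.sqrt d : ℂ))) = 34)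
    (N : ℕ) : HodgeConjectureFor (A.powSucc N).dim (A.powSucc N).X :=
  hodgeConjectureFor_of_isDivisorGenerated _
    (AbelianVariety.isDivisorGenerated_powSucc_of_onehundredonefold_thirtyFourSixtySeven A φ hd hφ hE2 hX h34 N)

/-- **Ribet 1983 Thm. 3 at `(n′, n″) = (40, 61)` — UNCONDITIONAL** (core `UnitaryFortySixtyOne.eq_top_of_smul`).
[cite: Ribet1983, Thm. 0 and Thm. 3] [cite: Gordon1997, Thm. 6.3 (3) and Corollary] -/
theorem AbelianVariety.isDivisorGenerated_powSucc_of_ribetTypeFortySixtyOne (A : AbelianVariety ℂ) (φ : A ⟶ A)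
    {d : ℕ} (hd : 0 < d) (hφ : φ ≫ φ = -(d • 𝟙 A)) (hE2 : Module.finrank ℚ A.endAlgebra = 2)
    (h40 : eigenMultiplicity A φ (Complex.I * (Real.sqrt d : ℂ)) = 40)
    (h61 : eigenMultiplicity A φ (-(Complex.I * (Real.sqrt d : ℂ))) = 61) (N : ℕ) :
    IsDivisorGenerated (A.powSucc N) := by
  refine AbelianVariety.isDivisorGenerated_powSucc_of_ribetType_ofCoreSmul A φ hd hφ hE2 (by omega) (by omega) ?_ N
  intro W' _ _ _ 𝔊 ι P' Q' s hbr hirr hι hιι hP' hQ' hfinP' hfinQ' hadd hsmul hsymm hPQ hdefP hdefQ hadj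
  exact UnitaryFortySixtyOne.eq_top_of_smul hbr hirr hι hιι hP' hQ' (by rw [hfinP', h40]) (by rw [hfinQ', h61]) hadd
    hsmul hsymm hPQ hdefP hdefQ hadj

/-- The mirror: `n_{i√d}(φ) = 61`, `n_{−i√d}(φ) = 40` (core `UnitaryFortySixtyOne.eq_top_of_smul'`).
[cite: Ribet1983, Thm. 0 and Thm. 3] [cite: Gordon1997, Thm. 6.3 (3) and Corollary] -/
theorem AbelianVariety.isDivisorGenerated_powSucc_of_ribetTypeFortySixtyOne' (A : AbelianVariety ℂ) (φ : A ⟶ A)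
    {d : ℕ} (hd : 0 < d) (hφ : φ ≫ φ = -(d • 𝟙 A)) (hE2 : Module.finrank ℚ A.endAlgebra = 2)
    (h61 : eigenMultiplicity A φ (Complex.I * (Real.sqrt d : ℂ)) = 61)
    (h40 : eigenMultiplicity A φ (-(Complex.I * (Real.sqrt d : ℂ))) = 40) (N : ℕ) :
    IsDivisorGenerated (A.powSucc N) := by
  refine AbelianVariety.isDivisorGenerated_powSucc_of_ribetType_ofCoreSmul A φ hd hφ hE2 (by omega) (by omega) ?_ N
  intro W' _ _ _ 𝔊 ι P' Q' s hbr hirr hι hιι hP' hQ' hfinP' hfinQ' hadd hsmul hsymm hPQ hdefP hdefQ hadj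
  exact UnitaryFortySixtyOne.eq_top_of_smul' hbr hirr hι hιι hP' hQ' (by rw [hfinP', h61]) (by rw [hfinQ', h40])
    hadd hsmul hsymm hPQ hdefP hdefQ hadj

/-- **The Hodge conjecture for all powers `A^{N+1}` of an abelian variety of Ribet type `(40, 61)` — UNCONDITIONAL.**
[cite: Ribet1983, Thm. 3] [cite: Deligne2000, §1] -/
theorem hodgeConjectureFor_powSucc_of_ribetTypeFortySixtyOne (A : AbelianVariety ℂ) (φ : A ⟶ A)
    {d : ℕ} (hd : 0 < d) (hφ : φ ≫ φ = -(d • 𝟙 A)) (hE2 : Module.finrank ℚ A.endAlgebra = 2)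
    (h40 : eigenMultiplicity A φ (Complex.I * (Real.sqrt d : ℂ)) = 40)
    (h61 : eigenMultiplicity A φ (-(Complex.I * (Real.sqrt d : ℂ))) = 61) (N : ℕ) :
    HodgeConjectureFor (A.powSucc N).dim (A.powSucc N).X :=
  hodgeConjectureFor_of_isDivisorGenerated _
    (AbelianVariety.isDivisorGenerated_powSucc_of_ribetTypeFortySixtyOne A φ hd hφ hE2 h40 h61 N)

/-- **101-FOLDS of signature `{40, 61}`: `B• = D•` on all powers — UNCONDITIONAL** (either eigenvalue may carry the `40`).
[cite: Ribet1983, Thm. 0 and Thm. 3] [cite: MoonenZarhin1999LowDim, §2 (2.4)] -/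
theorem AbelianVariety.isDivisorGenerated_powSucc_of_onehundredonefold_fortySixtyOne (A : AbelianVariety ℂ)
    (φ : A ⟶ A) {d : ℕ} (hd : 0 < d) (hφ : φ ≫ φ = -(d • 𝟙 A)) (hE2 : Module.finrank ℚ A.endAlgebra = 2)
    (hX : A.dim = 101)
    (h40 : eigenMultiplicity A φ (Complex.I * (Real.sqrt d : ℂ)) = 40 ∨
      eigenMultiplicity A φ (-(Complex.I * (Real.sqrt d : ℂ))) = 40)
    (N : ℕ) : IsDivisorGenerated (A.powSucc N) := by
  have hsum := eigenMultiplicity_add_eigenMultiplicity_neg_eq_dim A φ hd hφ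
  rw [hX] at hsum
  rcases h40 with h | h
  · exact AbelianVariety.isDivisorGenerated_powSucc_of_ribetTypeFortySixtyOne A φ hd hφ hE2 h (by omega) N
  · exact AbelianVariety.isDivisorGenerated_powSucc_of_ribetTypeFortySixtyOne' A φ hd hφ hE2 (by omega) h N

/-- **The Hodge conjecture for all powers of a 101-FOLD of signature `{40, 61}` — UNCONDITIONAL.**
[cite: Ribet1983, Thm. 3] [cite: Deligne2000, §1] -/
theorem hodgeConjectureFor_powSucc_of_onehundredonefold_fortySixtyOne (A : AbelianVariety ℂ)
    (φ : A ⟶ A) {d : ℕ} (hd : 0 < d) (hφ : φ ≫ φ = -(d • 𝟙 A)) (hE2 : Module.finrank ℚ A.endAlgebra = 2)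
    (hX : A.dim = 101)
    (h40 : eigenMultiplicity A φ (Complex.I * (Real.sqrt d : ℂ)) = 40 ∨
      eigenMultiplicity A φ (-(Complex.I * (Real.sqrt d : ℂ))) = 40)
    (N : ℕ) : HodgeConjectureFor (A.powSucc N).dim (A.powSucc N).X :=
  hodgeConjectureFor_of_isDivisorGenerated _
    (AbelianVariety.isDivisorGenerated_powSucc_of_onehundredonefold_fortySixtyOne A φ hd hφ hE2 hX h40 N)

/-- **Ribet 1983 Thm. 3 at `(n′, n″) = (42, 59)` — UNCONDITIONAL** (core `UnitaryFortyTwoFiftyNine.eq_top_of_smul`).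
[cite: Ribet1983, Thm. 0 and Thm. 3] [cite: Gordon1997, Thm. 6.3 (3) and Corollary] -/
theorem AbelianVariety.isDivisorGenerated_powSucc_of_ribetTypeFortyTwoFiftyNine (A : AbelianVariety ℂ) (φ : A ⟶ A)
    {d : ℕ} (hd : 0 < d) (hφ : φ ≫ φ = -(d • 𝟙 A)) (hE2 : Module.finrank ℚ A.endAlgebra = 2)
    (h42 : eigenMultiplicity A φ (Complex.I * (Real.sqrt d : ℂ)) = 42)
    (h59 : eigenMultiplicity A φ (-(Complex.I * (Real.sqrt d : ℂ))) = 59) (N : ℕ) :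
    IsDivisorGenerated (A.powSucc N) := by
  refine AbelianVariety.isDivisorGenerated_powSucc_of_ribetType_ofCoreSmul A φ hd hφ hE2 (by omega) (by omega) ?_ N
  intro W' _ _ _ 𝔊 ι P' Q' s hbr hirr hι hιι hP' hQ' hfinP' hfinQ' hadd hsmul hsymm hPQ hdefP hdefQ hadj
  exact UnitaryFortyTwoFiftyNine.eq_top_of_smul hbr hirr hι hιι hP' hQ' (by rw [hfinP', h42]) (by rw [hfinQ', h59]) hadd
    hsmul hsymm hPQ hdefP hdefQ hadj

/-- The mirror: `n_{i√d}(φ) = 59`, `n_{−i√d}(φ) = 42` (core `UnitaryFortyTwoFiftyNine.eq_top_of_smul'`).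
[cite: Ribet1983, Thm. 0 and Thm. 3] [cite: Gordon1997, Thm. 6.3 (3) and Corollary] -/
theorem AbelianVariety.isDivisorGenerated_powSucc_of_ribetTypeFortyTwoFiftyNine' (A : AbelianVariety ℂ) (φ : A ⟶ A)
    {d : ℕ} (hd : 0 < d) (hφ : φ ≫ φ = -(d • 𝟙 A)) (hE2 : Module.finrank ℚ A.endAlgebra = 2)
    (h59 : eigenMultiplicity A φ (Complex.I * (Real.sqrt d : ℂ)) = 59)
    (h42 : eigenMultiplicity A φ (-(Complex.I * (Real.sqrt d : ℂ))) = 42) (N : ℕ) :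
    IsDivisorGenerated (A.powSucc N) := by
  refine AbelianVariety.isDivisorGenerated_powSucc_of_ribetType_ofCoreSmul A φ hd hφ hE2 (by omega) (by omega) ?_ N
  intro W' _ _ _ 𝔊 ι P' Q' s hbr hirr hι hιι hP' hQ' hfinP' hfinQ' hadd hsmul hsymm hPQ hdefP hdefQ hadj
  exact UnitaryFortyTwoFiftyNine.eq_top_of_smul' hbr hirr hι hιι hP' hQ' (by rw [hfinP', h59]) (by rw [hfinQ', h42])
    hadd hsmul hsymm hPQ hdefP hdefQ hadj

/-- **The Hodge conjecture for all powers `A^{N+1}` of an abelian variety of Ribet type `(42, 59)` — UNCONDITIONAL.**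
[cite: Ribet1983, Thm. 3] [cite: Deligne2000, §1] -/
theorem hodgeConjectureFor_powSucc_of_ribetTypeFortyTwoFiftyNine (A : AbelianVariety ℂ) (φ : A ⟶ A)
    {d : ℕ} (hd : 0 < d) (hφ : φ ≫ φ = -(d • 𝟙 A)) (hE2 : Module.finrank ℚ A.endAlgebra = 2)
    (h42 : eigenMultiplicity A φ (Complex.I * (Real.sqrt d : ℂ)) = 42)
    (h59 : eigenMultiplicity A φ (-(Complex.I * (Real.sqrt d : ℂ))) = 59) (N : ℕ) :
    HodgeConjectureFor (A.powSucc N).dim (A.powSucc N).X :=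
  hodgeConjectureFor_of_isDivisorGenerated _
    (AbelianVariety.isDivisorGenerated_powSucc_of_ribetTypeFortyTwoFiftyNine A φ hd hφ hE2 h42 h59 N)

/-- **101-FOLDS of signature `{42, 59}`: `B• = D•` on all powers — UNCONDITIONAL** (either eigenvalue may carry the `42`).
[cite: Ribet1983, Thm. 0 and Thm. 3] [cite: MoonenZarhin1999LowDim, §2 (2.4)] -/
theorem AbelianVariety.isDivisorGenerated_powSucc_of_onehundredonefold_fortyTwoFiftyNine (A : AbelianVariety ℂ)
    (φ : A ⟶ A) {d : ℕ} (hd : 0 < d) (hφ : φ ≫ φ = -(d • 𝟙 A)) (hE2 : Module.finrank ℚ A.endAlgebra = 2)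
    (hX : A.dim = 101)
    (h42 : eigenMultiplicity A φ (Complex.I * (Real.sqrt d : ℂ)) = 42 ∨
      eigenMultiplicity A φ (-(Complex.I * (Real.sqrt d : ℂ))) = 42)
    (N : ℕ) : IsDivisorGenerated (A.powSucc N) := by
  have hsum := eigenMultiplicity_add_eigenMultiplicity_neg_eq_dim A φ hd hφ
  rw [hX] at hsum
  rcases h42 with h | h
  · exact AbelianVariety.isDivisorGenerated_powSucc_of_ribetTypeFortyTwoFiftyNine A φ hd hφ hE2 h (by omega) N
  · exact AbelianVariety.isDivisorGenerated_powSucc_of_ribetTypeFortyTwoFiftyNine' A φ hd hφ hE2 (by omega) h N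

/-- **The Hodge conjecture for all powers of a 101-FOLD of signature `{42, 59}` — UNCONDITIONAL.**
[cite: Ribet1983, Thm. 3] [cite: Deligne2000, §1] -/
theorem hodgeConjectureFor_powSucc_of_onehundredonefold_fortyTwoFiftyNine (A : AbelianVariety ℂ)
    (φ : A ⟶ A) {d : ℕ} (hd : 0 < d) (hφ : φ ≫ φ = -(d • 𝟙 A)) (hE2 : Module.finrank ℚ A.endAlgebra = 2)
    (hX : A.dim = 101)
    (h42 : eigenMultiplicity A φ (Complex.I * (Real.sqrt d : ℂ)) = 42 ∨
      eigenMultiplicity A φ (-(Complex.I * (Real.sqrt d : ℂ))) = 42)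
    (N : ℕ) : HodgeConjectureFor (A.powSucc N).dim (A.powSucc N).X :=
  hodgeConjectureFor_of_isDivisorGenerated _
    (AbelianVariety.isDivisorGenerated_powSucc_of_onehundredonefold_fortyTwoFiftyNine A φ hd hφ hE2 hX h42 N)

/-- **Ribet 1983 Thm. 3 at `(n′, n″) = (48, 53)` — UNCONDITIONAL** (core `UnitaryFortyEightFiftyThree.eq_top_of_smul`).
[cite: Ribet1983, Thm. 0 and Thm. 3] [cite: Gordon1997, Thm. 6.3 (3) and Corollary] -/
theorem AbelianVariety.isDivisorGenerated_powSucc_of_ribetTypeFortyEightFiftyThree (A : AbelianVariety ℂ) (φ : A ⟶ A)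
    {d : ℕ} (hd : 0 < d) (hφ : φ ≫ φ = -(d • 𝟙 A)) (hE2 : Module.finrank ℚ A.endAlgebra = 2)
    (h48 : eigenMultiplicity A φ (Complex.I * (Real.sqrt d : ℂ)) = 48)
    (h53 : eigenMultiplicity A φ (-(Complex.I * (Real.sqrt d : ℂ))) = 53) (N : ℕ) :
    IsDivisorGenerated (A.powSucc N) := by
  refine AbelianVariety.isDivisorGenerated_powSucc_of_ribetType_ofCoreSmul A φ hd hφ hE2 (by omega) (by omega) ?_ N
  intro W' _ _ _ 𝔊 ι P' Q' s hbr hirr hι hιι hP' hQ' hfinP' hfinQ' hadd hsmul hsymm hPQ hdefP hdefQ hadj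
  exact UnitaryFortyEightFiftyThree.eq_top_of_smul hbr hirr hι hιι hP' hQ' (by rw [hfinP', h48]) (by rw [hfinQ', h53]) hadd
    hsmul hsymm hPQ hdefP hdefQ hadj

/-- The mirror: `n_{i√d}(φ) = 53`, `n_{−i√d}(φ) = 48` (core `UnitaryFortyEightFiftyThree.eq_top_of_smul'`).
[cite: Ribet1983, Thm. 0 and Thm. 3] [cite: Gordon1997, Thm. 6.3 (3) and Corollary] -/
theorem AbelianVariety.isDivisorGenerated_powSucc_of_ribetTypeFortyEightFiftyThree' (A : AbelianVariety ℂ) (φ : A ⟶ A)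
    {d : ℕ} (hd : 0 < d) (hφ : φ ≫ φ = -(d • 𝟙 A)) (hE2 : Module.finrank ℚ A.endAlgebra = 2)
    (h53 : eigenMultiplicity A φ (Complex.I * (Real.sqrt d : ℂ)) = 53)
    (h48 : eigenMultiplicity A φ (-(Complex.I * (Real.sqrt d : ℂ))) = 48) (N : ℕ) :
    IsDivisorGenerated (A.powSucc N) := by
  refine AbelianVariety.isDivisorGenerated_powSucc_of_ribetType_ofCoreSmul A φ hd hφ hE2 (by omega) (by omega) ?_ N
  intro W' _ _ _ 𝔊 ι P' Q' s hbr hirr hι hιι hP' hQ' hfinP' hfinQ' hadd hsmul hsymm hPQ hdefP hdefQ hadj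
  exact UnitaryFortyEightFiftyThree.eq_top_of_smul' hbr hirr hι hιι hP' hQ' (by rw [hfinP', h53]) (by rw [hfinQ', h48])
    hadd hsmul hsymm hPQ hdefP hdefQ hadj

/-- **The Hodge conjecture for all powers `A^{N+1}` of an abelian variety of Ribet type `(48, 53)` — UNCONDITIONAL.**
[cite: Ribet1983, Thm. 3] [cite: Deligne2000, §1] -/
theorem hodgeConjectureFor_powSucc_of_ribetTypeFortyEightFiftyThree (A : AbelianVariety ℂ) (φ : A ⟶ A)
    {d : ℕ} (hd : 0 < d) (hφ : φ ≫ φ = -(d • 𝟙 A)) (hE2 : Module.finrank ℚ A.endAlgebra = 2)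
    (h48 : eigenMultiplicity A φ (Complex.I * (Real.sqrt d : ℂ)) = 48)
    (h53 : eigenMultiplicity A φ (-(Complex.I * (Real.sqrt d : ℂ))) = 53) (N : ℕ) :
    HodgeConjectureFor (A.powSucc N).dim (A.powSucc N).X :=
  hodgeConjectureFor_of_isDivisorGenerated _
    (AbelianVariety.isDivisorGenerated_powSucc_of_ribetTypeFortyEightFiftyThree A φ hd hφ hE2 h48 h53 N)

/-- **101-FOLDS of signature `{48, 53}`: `B• = D•` on all powers — UNCONDITIONAL** (either eigenvalue may carry the `48`).
[cite: Ribet1983, Thm. 0 and Thm. 3] [cite: MoonenZarhin1999LowDim, §2 (2.4)] -/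
theorem AbelianVariety.isDivisorGenerated_powSucc_of_onehundredonefold_fortyEightFiftyThree (A : AbelianVariety ℂ)
    (φ : A ⟶ A) {d : ℕ} (hd : 0 < d) (hφ : φ ≫ φ = -(d • 𝟙 A)) (hE2 : Module.finrank ℚ A.endAlgebra = 2)
    (hX : A.dim = 101)
    (h48 : eigenMultiplicity A φ (Complex.I * (Real.sqrt d : ℂ)) = 48 ∨
      eigenMultiplicity A φ (-(Complex.I * (Real.sqrt d : ℂ))) = 48)
    (N : ℕ) : IsDivisorGenerated (A.powSucc N) := by
  have hsum := eigenMultiplicity_add_eigenMultiplicity_neg_eq_dim A φ hd hφ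
  rw [hX] at hsum
  rcases h48 with h | h
  · exact AbelianVariety.isDivisorGenerated_powSucc_of_ribetTypeFortyEightFiftyThree A φ hd hφ hE2 h (by omega) N
  · exact AbelianVariety.isDivisorGenerated_powSucc_of_ribetTypeFortyEightFiftyThree' A φ hd hφ hE2 (by omega) h N

/-- **The Hodge conjecture for all powers of a 101-FOLD of signature `{48, 53}` — UNCONDITIONAL.**
[cite: Ribet1983, Thm. 3] [cite: Deligne2000, §1] -/
theorem hodgeConjectureFor_powSucc_of_onehundredonefold_fortyEightFiftyThree (A : AbelianVariety ℂ)
    (φ : A ⟶ A) {d : ℕ} (hd : 0 < d) (hφ : φ ≫ φ = -(d • 𝟙 A)) (hE2 : Module.finrank ℚ A.endAlgebra = 2)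
    (hX : A.dim = 101)
    (h48 : eigenMultiplicity A φ (Complex.I * (Real.sqrt d : ℂ)) = 48 ∨
      eigenMultiplicity A φ (-(Complex.I * (Real.sqrt d : ℂ))) = 48)
    (N : ℕ) : HodgeConjectureFor (A.powSucc N).dim (A.powSucc N).X :=
  hodgeConjectureFor_of_isDivisorGenerated _
    (AbelianVariety.isDivisorGenerated_powSucc_of_onehundredonefold_fortyEightFiftyThree A φ hd hφ hE2 hX h48 N)

end Cells

/-! ### §2 The 101-fold census -/

section Census

variable {X : AbelianVariety ℂ}

/-- **`B• = D•` on all powers of a SIMPLE complex abelian `101`-FOLD, granted ONLY `End⁰ = ℚ` and the `k`-signatures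
`{8, 93}`, `{9, 92}`, `{10, 91}`, `{14, 87}`, `{15, 86}`, `{16, 85}`, `{17, 84}`, `{19, 82}`, `{20, 81}`, `{21, 80}`, `{23, 78}`, `{24, 77}`, `{25, 76}`, `{26, 75}`, `{27, 74}`, `{29, 72}`, `{31, 70}`, `{32, 69}`, `{33, 68}`, `{35, 66}`, `{36, 65}`, `{37, 64}`, `{38, 63}`, `{39, 62}`, `{41, 60}`, `{43, 58}`, `{44, 57}`, `{45, 56}`, `{46, 55}`, `{47, 54}`, `{49, 52}`, `{50, 51}`** (the shapes with a
multiplicity `≤ 7` or in `{11, 13}` are generic tree theorems; `{12, 89}`, `{18, 83}`, `{22, 79}`, `{28, 73}`, `{30, 71}`, `{34, 67}`, `{40, 61}`, `{42, 59}`, `{48, 53}` are cells).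
[cite: MoonenZarhin1999LowDim, §2 (2.4) and Thm. (2.7)] [cite: Ribet1983, Thms. 0–3] [cite: Gordon1997, Thm. 6.3 and Corollary] -/
theorem isDivisorGenerated_powSucc_of_isSimple_onehundredonefold (hs : X.IsSimple) (hX : X.dim = 101)
    (h1 : Module.finrank ℚ X.endAlgebra = 1 → ∀ N : ℕ, IsDivisorGenerated (X.powSucc N))
    (hres : ∀ (φ : X ⟶ X) (d : ℕ), 0 < d → φ ≫ φ = -(d • 𝟙 X) → Module.finrank ℚ X.endAlgebra = 2 →
      (eigenMultiplicity X φ (Complex.I * (Real.sqrt d : ℂ)) = 8 ∨ eigenMultiplicity X φ (Complex.I * (Real.sqrt d : ℂ)) = 9 ∨ eigenMultiplicity X φ (Complex.I * (Real.sqrt d : ℂ)) = 10 ∨ eigenMultiplicity X φ (Complex.I * (Real.sqrt d : ℂ)) = 14 ∨ eigenMultiplicity X φ (Complex.I * (Real.sqrt d : ℂ)) = 15 ∨ eigenMultiplicity X φ (Complex.I * (Real.sqrt d : ℂ)) = 16 ∨ eigenMultiplicity X φ (Complex.I * (Real.sqrt d : ℂ)) = 17 ∨ eigenMultiplicity X φ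 (Complex.I * (Real.sqrt d : ℂ)) = 19 ∨ eigenMultiplicity X φ (Complex.I * (Real.sqrt d : ℂ)) = 20 ∨ eigenMultiplicity X φ (Complex.I * (Real.sqrt d : ℂ)) = 21 ∨ eigenMultiplicity X φ (Complex.I * (Real.sqrt d : ℂ)) = 23 ∨ eigenMultiplicity X φ (Complex.I * (Real.sqrt d : ℂ)) = 24 ∨ eigenMultiplicity X φ (Complex.I * (Real.sqrt d : ℂ)) = 25 ∨ eigenMultiplicity X φ (Complex.I * (Real.sqrt d : ℂ)) = 26 ∨ eigenMultiplicity X φ (Complex.I * (Real.sqrt d : ℂ)) = 27 ∨ eigenMultiplicity X φ (Complex.I * (Real.sqrt d : ℂ)) = 29 ∨ eigenMultiplicity X φ (Complex.I * (Real.sqrt d : ℂ)) = 31 ∨ eigenMultiplicity X φ (Complex.I * (Real.sqrt d : ℂ)) = 32 ∨ eigenMultiplicity X φ (Complex.I * (Real.sqrt d : ℂ)) = 33 ∨ eigenMultiplicity X φ (Complex.I * (Real.sqrt d : ℂ)) = 35 ∨ eigenMultiplicity X φ (Complex.I * (Real.sqrt d : ℂ)) = 36 ∨ eigenMultiplicity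 X φ (Complex.I * (Real.sqrt d : ℂ)) = 37 ∨ eigenMultiplicity X φ (Complex.I * (Real.sqrt d : ℂ)) = 38 ∨ eigenMultiplicity X φ (Complex.I * (Real.sqrt d : ℂ)) = 39 ∨ eigenMultiplicity X φ (Complex.I * (Real.sqrt d : ℂ)) = 41 ∨ eigenMultiplicity X φ (Complex.I * (Real.sqrt d : ℂ)) = 43 ∨ eigenMultiplicity X φ (Complex.I * (Real.sqrt d : ℂ)) = 44 ∨ eigenMultiplicity X φ (Complex.I * (Real.sqrt d : ℂ)) = 45 ∨ eigenMultiplicity X φ (Complex.I * (Real.sqrt d : ℂ)) = 46 ∨ eigenMultiplicity X φ (Complex.I * (Real.sqrt d : ℂ)) = 47 ∨ eigenMultiplicity X φ (Complex.I * (Real.sqrt d : ℂ)) = 49 ∨ eigenMultiplicity X φ (Complex.I * (Real.sqrt d : ℂ)) = 50 ∨ eigenMultiplicity X φ (Complex.I * (Real.sqrt d : ℂ)) = 51 ∨ eigenMultiplicity X φ (Complex.I * (Real.sqrt d : ℂ)) = 52 ∨ eigenMultiplicity X φ (Complex.I * (Real.sqrt d : ℂ)) = 54 ∨ eigenMultiplicity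 X φ (Complex.I * (Real.sqrt d : ℂ)) = 55 ∨ eigenMultiplicity X φ (Complex.I * (Real.sqrt d : ℂ)) = 56 ∨ eigenMultiplicity X φ (Complex.I * (Real.sqrt d : ℂ)) = 57 ∨ eigenMultiplicity X φ (Complex.I * (Real.sqrt d : ℂ)) = 58 ∨ eigenMultiplicity X φ (Complex.I * (Real.sqrt d : ℂ)) = 60 ∨ eigenMultiplicity X φ (Complex.I * (Real.sqrt d : ℂ)) = 62 ∨ eigenMultiplicity X φ (Complex.I * (Real.sqrt d : ℂ)) = 63 ∨ eigenMultiplicity X φ (Complex.I * (Real.sqrt d : ℂ)) = 64 ∨ eigenMultiplicity X φ (Complex.I * (Real.sqrt d : ℂ)) = 65 ∨ eigenMultiplicity X φ (Complex.I * (Real.sqrt d : ℂ)) = 66 ∨ eigenMultiplicity X φ (Complex.I * (Real.sqrt d : ℂ)) = 68 ∨ eigenMultiplicity X φ (Complex.I * (Real.sqrt d : ℂ)) = 69 ∨ eigenMultiplicity X φ (Complex.I * (Real.sqrt d : ℂ)) = 70 ∨ eigenMultiplicity X φ (Complex.I * (Real.sqrt d : ℂ)) = 72 ∨ eigenMultiplicity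 X φ (Complex.I * (Real.sqrt d : ℂ)) = 74 ∨ eigenMultiplicity X φ (Complex.I * (Real.sqrt d : ℂ)) = 75 ∨ eigenMultiplicity X φ (Complex.I * (Real.sqrt d : ℂ)) = 76 ∨ eigenMultiplicity X φ (Complex.I * (Real.sqrt d : ℂ)) = 77 ∨ eigenMultiplicity X φ (Complex.I * (Real.sqrt d : ℂ)) = 78 ∨ eigenMultiplicity X φ (Complex.I * (Real.sqrt d : ℂ)) = 80 ∨ eigenMultiplicity X φ (Complex.I * (Real.sqrt d : ℂ)) = 81 ∨ eigenMultiplicity X φ (Complex.I * (Real.sqrt d : ℂ)) = 82 ∨ eigenMultiplicity X φ (Complex.I * (Real.sqrt d : ℂ)) = 84 ∨ eigenMultiplicity X φ (Complex.I * (Real.sqrt d : ℂ)) = 85 ∨ eigenMultiplicity X φ (Complex.I * (Real.sqrt d : ℂ)) = 86 ∨ eigenMultiplicity X φ (Complex.I * (Real.sqrt d : ℂ)) = 87 ∨ eigenMultiplicity X φ (Complex.I * (Real.sqrt d : ℂ)) = 91 ∨ eigenMultiplicity X φ (Complex.I * (Real.sqrt d : ℂ)) = 92 ∨ eigenMultiplicity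 X φ (Complex.I * (Real.sqrt d : ℂ)) = 93) →
      ∀ N : ℕ, IsDivisorGenerated (X.powSucc N))
    (N : ℕ) : IsDivisorGenerated (X.powSucc N) := by
  refine isDivisorGenerated_powSucc_of_isSimple_of_prime_of_odd_of_ge_eight_notin hs (by rw [hX]; norm_num)
    (by rw [hX]; exact ⟨50, rfl⟩) h1 (fun φ d hd hφ he2 ha hb h11a h11b h13a h13b N => ?_) N
  have hsum := eigenMultiplicity_add_eigenMultiplicity_neg_eq_dim X φ hd hφ
  rw [hX] at hsum
  by_cases h12 : eigenMultiplicity X φ (Complex.I * (Real.sqrt d : ℂ)) = 12 ∨ eigenMultiplicity X φ (-(Complex.I * (Real.sqrt d : ℂ))) = 12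
  · exact AbelianVariety.isDivisorGenerated_powSucc_of_onehundredonefold_twelveEightyNine X φ hd hφ he2 hX h12 N
  by_cases h18 : eigenMultiplicity X φ (Complex.I * (Real.sqrt d : ℂ)) = 18 ∨ eigenMultiplicity X φ (-(Complex.I * (Real.sqrt d : ℂ))) = 18
  · exact AbelianVariety.isDivisorGenerated_powSucc_of_onehundredonefold_eighteenEightyThree X φ hd hφ he2 hX h18 N
  by_cases h22 : eigenMultiplicity X φ (Complex.I * (Real.sqrt d : ℂ)) = 22 ∨ eigenMultiplicity X φ (-(Complex.I * (Real.sqrt d : ℂ))) = 22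
  · exact AbelianVariety.isDivisorGenerated_powSucc_of_onehundredonefold_twentyTwoSeventyNine X φ hd hφ he2 hX h22 N
  by_cases h28 : eigenMultiplicity X φ (Complex.I * (Real.sqrt d : ℂ)) = 28 ∨ eigenMultiplicity X φ (-(Complex.I * (Real.sqrt d : ℂ))) = 28
  · exact AbelianVariety.isDivisorGenerated_powSucc_of_onehundredonefold_twentyEightSeventyThree X φ hd hφ he2 hX h28 N
  by_cases h30 : eigenMultiplicity X φ (Complex.I * (Real.sqrt d : ℂ)) = 30 ∨ eigenMultiplicity X φ (-(Complex.I * (Real.sqrt d : ℂ))) = 30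
  · exact AbelianVariety.isDivisorGenerated_powSucc_of_onehundredonefold_thirtySeventyOne X φ hd hφ he2 hX h30 N
  by_cases h34 : eigenMultiplicity X φ (Complex.I * (Real.sqrt d : ℂ)) = 34 ∨ eigenMultiplicity X φ (-(Complex.I * (Real.sqrt d : ℂ))) = 34
  · exact AbelianVariety.isDivisorGenerated_powSucc_of_onehundredonefold_thirtyFourSixtySeven X φ hd hφ he2 hX h34 N
  by_cases h40 : eigenMultiplicity X φ (Complex.I * (Real.sqrt d : ℂ)) = 40 ∨ eigenMultiplicity X φ (-(Complex.I * (Real.sqrt d : ℂ))) = 40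
  · exact AbelianVariety.isDivisorGenerated_powSucc_of_onehundredonefold_fortySixtyOne X φ hd hφ he2 hX h40 N
  by_cases h42 : eigenMultiplicity X φ (Complex.I * (Real.sqrt d : ℂ)) = 42 ∨ eigenMultiplicity X φ (-(Complex.I * (Real.sqrt d : ℂ))) = 42
  · exact AbelianVariety.isDivisorGenerated_powSucc_of_onehundredonefold_fortyTwoFiftyNine X φ hd hφ he2 hX h42 N
  by_cases h48 : eigenMultiplicity X φ (Complex.I * (Real.sqrt d : ℂ)) = 48 ∨ eigenMultiplicity X φ (-(Complex.I * (Real.sqrt d : ℂ))) = 48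
  · exact AbelianVariety.isDivisorGenerated_powSucc_of_onehundredonefold_fortyEightFiftyThree X φ hd hφ he2 hX h48 N
  exact hres φ d hd hφ he2 (by omega) N

/-- **The Hodge conjecture on all powers of a SIMPLE complex abelian `101`-FOLD, granted ONLY `End⁰ = ℚ` and the
`k`-signatures above.** [cite: Ribet1983, Thms. 0–3] [cite: Deligne2000, §1] -/
theorem hodgeConjectureFor_powSucc_of_isSimple_onehundredonefold (hs : X.IsSimple) (hX : X.dim = 101)
    (h1 : Module.finrank ℚ X.endAlgebra = 1 → ∀ N : ℕ, IsDivisorGenerated (X.powSucc N))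
    (hres : ∀ (φ : X ⟶ X) (d : ℕ), 0 < d → φ ≫ φ = -(d • 𝟙 X) → Module.finrank ℚ X.endAlgebra = 2 →
      (eigenMultiplicity X φ (Complex.I * (Real.sqrt d : ℂ)) = 8 ∨ eigenMultiplicity X φ (Complex.I * (Real.sqrt d : ℂ)) = 9 ∨ eigenMultiplicity X φ (Complex.I * (Real.sqrt d : ℂ)) = 10 ∨ eigenMultiplicity X φ (Complex.I * (Real.sqrt d : ℂ)) = 14 ∨ eigenMultiplicity X φ (Complex.I * (Real.sqrt d : ℂ)) = 15 ∨ eigenMultiplicity X φ (Complex.I * (Real.sqrt d : ℂ)) = 16 ∨ eigenMultiplicity X φ (Complex.I * (Real.sqrt d : ℂ)) = 17 ∨ eigenMultiplicity X φ (Complex.I * (Real.sqrt d : ℂ)) = 19 ∨ eigenMultiplicity X φ (Complex.I * (Real.sqrt d : ℂ)) = 20 ∨ eigenMultiplicity X φ (Complex.I * (Real.sqrt d : ℂ)) = 21 ∨ eigenMultiplicity X φ (Complex.I * (Real.sqrt d : ℂ)) = 23 ∨ eigenMultiplicity X φ (Complex.I * (Real.sqrt d : ℂ)) = 24 ∨ eigenMultiplicity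 X φ (Complex.I * (Real.sqrt d : ℂ)) = 25 ∨ eigenMultiplicity X φ (Complex.I * (Real.sqrt d : ℂ)) = 26 ∨ eigenMultiplicity X φ (Complex.I * (Real.sqrt d : ℂ)) = 27 ∨ eigenMultiplicity X φ (Complex.I * (Real.sqrt d : ℂ)) = 29 ∨ eigenMultiplicity X φ (Complex.I * (Real.sqrt d : ℂ)) = 31 ∨ eigenMultiplicity X φ (Complex.I * (Real.sqrt d : ℂ)) = 32 ∨ eigenMultiplicity X φ (Complex.I * (Real.sqrt d : ℂ)) = 33 ∨ eigenMultiplicity X φ (Complex.I * (Real.sqrt d : ℂ)) = 35 ∨ eigenMultiplicity X φ (Complex.I * (Real.sqrt d : ℂ)) = 36 ∨ eigenMultiplicity X φ (Complex.I * (Real.sqrt d : ℂ)) = 37 ∨ eigenMultiplicity X φ (Complex.I * (Real.sqrt d : ℂ)) = 38 ∨ eigenMultiplicity X φ (Complex.I * (Real.sqrt d : ℂ)) = 39 ∨ eigenMultiplicity X φ (Complex.I * (Real.sqrt d : ℂ)) = 41 ∨ eigenMultiplicity X φ (Complex.I * (Real.sqrt d : ℂ)) = 43 ∨ eigenMultiplicity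 X φ (Complex.I * (Real.sqrt d : ℂ)) = 44 ∨ eigenMultiplicity X φ (Complex.I * (Real.sqrt d : ℂ)) = 45 ∨ eigenMultiplicity X φ (Complex.I * (Real.sqrt d : ℂ)) = 46 ∨ eigenMultiplicity X φ (Complex.I * (Real.sqrt d : ℂ)) = 47 ∨ eigenMultiplicity X φ (Complex.I * (Real.sqrt d : ℂ)) = 49 ∨ eigenMultiplicity X φ (Complex.I * (Real.sqrt d : ℂ)) = 50 ∨ eigenMultiplicity X φ (Complex.I * (Real.sqrt d : ℂ)) = 51 ∨ eigenMultiplicity X φ (Complex.I * (Real.sqrt d : ℂ)) = 52 ∨ eigenMultiplicity X φ (Complex.I * (Real.sqrt d : ℂ)) = 54 ∨ eigenMultiplicity X φ (Complex.I * (Real.sqrt d : ℂ)) = 55 ∨ eigenMultiplicity X φ (Complex.I * (Real.sqrt d : ℂ)) = 56 ∨ eigenMultiplicity X φ (Complex.I * (Real.sqrt d : ℂ)) = 57 ∨ eigenMultiplicity X φ (Complex.I * (Real.sqrt d : ℂ)) = 58 ∨ eigenMultiplicity X φ (Complex.I * (Real.sqrt d : ℂ)) = 60 ∨ eigenMultiplicity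 X φ (Complex.I * (Real.sqrt d : ℂ)) = 62 ∨ eigenMultiplicity X φ (Complex.I * (Real.sqrt d : ℂ)) = 63 ∨ eigenMultiplicity X φ (Complex.I * (Real.sqrt d : ℂ)) = 64 ∨ eigenMultiplicity X φ (Complex.I * (Real.sqrt d : ℂ)) = 65 ∨ eigenMultiplicity X φ (Complex.I * (Real.sqrt d : ℂ)) = 66 ∨ eigenMultiplicity X φ (Complex.I * (Real.sqrt d : ℂ)) = 68 ∨ eigenMultiplicity X φ (Complex.I * (Real.sqrt d : ℂ)) = 69 ∨ eigenMultiplicity X φ (Complex.I * (Real.sqrt d : ℂ)) = 70 ∨ eigenMultiplicity X φ (Complex.I * (Real.sqrt d : ℂ)) = 72 ∨ eigenMultiplicity X φ (Complex.I * (Real.sqrt d : ℂ)) = 74 ∨ eigenMultiplicity X φ (Complex.I * (Real.sqrt d : ℂ)) = 75 ∨ eigenMultiplicity X φ (Complex.I * (Real.sqrt d : ℂ)) = 76 ∨ eigenMultiplicity X φ (Complex.I * (Real.sqrt d : ℂ)) = 77 ∨ eigenMultiplicity X φ (Complex.I * (Real.sqrt d : ℂ)) = 78 ∨ eigenMultiplicity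 X φ (Complex.I * (Real.sqrt d : ℂ)) = 80 ∨ eigenMultiplicity X φ (Complex.I * (Real.sqrt d : ℂ)) = 81 ∨ eigenMultiplicity X φ (Complex.I * (Real.sqrt d : ℂ)) = 82 ∨ eigenMultiplicity X φ (Complex.I * (Real.sqrt d : ℂ)) = 84 ∨ eigenMultiplicity X φ (Complex.I * (Real.sqrt d : ℂ)) = 85 ∨ eigenMultiplicity X φ (Complex.I * (Real.sqrt d : ℂ)) = 86 ∨ eigenMultiplicity X φ (Complex.I * (Real.sqrt d : ℂ)) = 87 ∨ eigenMultiplicity X φ (Complex.I * (Real.sqrt d : ℂ)) = 91 ∨ eigenMultiplicity X φ (Complex.I * (Real.sqrt d : ℂ)) = 92 ∨ eigenMultiplicity X φ (Complex.I * (Real.sqrt d : ℂ)) = 93) →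
      ∀ N : ℕ, IsDivisorGenerated (X.powSucc N))
    (N : ℕ) : HodgeConjectureFor (X.powSucc N).dim (X.powSucc N).X :=
  hodgeConjectureFor_of_isDivisorGenerated _ (isDivisorGenerated_powSucc_of_isSimple_onehundredonefold hs hX h1 hres N)

end Census

end Literature.AlgebraicGeometry.HodgeTheory

end

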